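import Literature.RepresentationTheory.BorelWallach2000.U11ContragredientSocle
import Literature.Algebra.Module.SocleRadicalMultiplicity
import HarnessLib

/-!
# Irreducible quotients of `M` ⟷ irreducible submodules of the contragredient `M~` at `U(1,1)`:
# `M ↠ L ⟺ L~ ↪ M~` and `L ↪ M ⟺ M~ ↠ L~` (Borel–Wallach I §1–§2; Knapp–Vogan Prop. 2.53 (b))

Family `hodge`, lane `lit-hodgefound` (foundations library; seat `lit-hodgefound-p39`, generation 33, row g33-#13); topic
`RepresentationTheory/BorelWallach2000`, namespace `…BorelWallach2000.U11DualFunctor` (continued).  Sequel of `U11ContragredientSocle`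
(g33-#5: `[soc(M~) : L~] = [M / rad M : L]`, `[M~ / rad(M~) : L~] = [soc M : L]`) and of the generic g33-#12
`Algebra/Module/SocleRadicalMultiplicity` (`[M / rad M : S] ≥ 1 ⟺ M ↠ S`, `[soc M : S] ≥ 1 ⟺ S ↪ M`).  What is formalised — the
dictionary used when Langlands QUOTIENTS are turned into Langlands SUBREPRESENTATIONS by passing to the contragredient: for a
`(𝔤, K)`-module `M` of finite length of `U(1,1)` and an irreducible `L`,
**`L` is a quotient of `M` iff `L~` is a submodule of `M~`**, and **`L` is a submodule of `M` iff `L~` is a quotient of `M~`**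
(over the operator ring `R = GKRing G11`, `Hom_R = Hom_{(𝔤,K)}`), together with the `Hom ≠ 0` forms.
Theorems only, 0 `sorry`, no named fact (net debt 0, D-0026).

## The sources

A. Borel, N. Wallach, *Continuous Cohomology, Discrete Subgroups, and Representations of Reductive Groups* (2000) [BorelWallach2000,
0 §2.5, I §1–§2 (the contragredient `(𝔤, K)`-module)]; A. W. Knapp, D. A. Vogan (1995) [KnappVogan1995, §II.3 Prop. 2.53 (b): the
contravariant functor `V ↦ V~ = Hom(V, ℂ)_K` is exact]; H. Krause (2021) [Krause2021, Conventions «Socle», «Radical»]; A. J. Berrick,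
M. E. Keating (2000) [BerrickKeating2000, §4.1.13, Thm. 4.1.17].

## What is formalised (`R = GKRing G11`; `M~ = GKDual.dualModule G11 hM`)

* §1 **`exists_surjective_iff_exists_injective_dual : (∃ M ↠ L) ↔ (∃ L~ ↪ M~)`**, **`exists_injective_iff_exists_surjective_dual :
  (∃ L ↪ M) ↔ (∃ M~ ↠ L~)`** (`M` of finite length, `L` irreducible).
* §2 the `Hom ≠ 0` forms `exists_hom_ne_zero_iff_dual`, `exists_hom_ne_zero_iff_dual'`.
* §3 counted forms: `compMult_top_pos_iff_exists_injective_dual`, `compMult_socle_pos_iff_exists_surjective_dual`.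

## Mathlib / Literature search

g33-#5 `U11DualFunctor.compMult_socle_dualModule`, `compMult_top_dualModule`; g33-#12 `SocleRadical.compMult_top_pos_iff_exists_surjective`,
`compMult_socle_pos_iff_exists_injective`, `…_iff_exists_ne_zero`; g32 `isSimpleModule_dualModule_iff`, `isFiniteLength_dualModule_iff`;
`U11HC.isAdmissibleGK_of_isFiniteLength`.  `rg -n 'exists_surjective_iff|quotient.*iff.*submodule.*dual' BorelWallach2000` → nothing.

## References

* A. Borel, N. Wallach, *Continuous Cohomology, Discrete Subgroups, and Representations of Reductive Groups*, 2nd ed., AMS (2000),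
  0 §2.5, I §1–§2. [BorelWallach2000]
* A. W. Knapp, D. A. Vogan, *Cohomological Induction and Unitary Representations*, Princeton (1995), §II.3 Prop. 2.53. [KnappVogan1995]
* H. Krause, *Homological Theory of Representations* (2021), Conventions. [Krause2021]
* A. J. Berrick, M. E. Keating, *An Introduction to Rings and Modules* (2000), §4.1.13, Thm. 4.1.17. [BerrickKeating2000]
-/

noncomputable section

open scoped Matrix ComplexConjugate
open Module

namespace Literature.RepresentationTheory.BorelWallach2000

open Literature.Algebra.Lie Literature.Algebra.Lie.ChevalleyEilenberg
open Literature.Algebra.Module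
open Literature.NumberTheory.Automorphic
open Literature.RepresentationTheory.KonnoKonno2007 Literature.RepresentationTheory.KonnoKonno2007.RealDualPair
open Literature.RepresentationTheory.KonnoKonno2007.RealDualPair.UForm
open Literature.LinearAlgebra
open U11HolDS

-- Mathlib idiom (as in `GKModules`, `GKCohomology`): commutator bracket on `Module.End` / matrices
attribute [local instance 100] LieRing.ofAssociativeRing

namespace U11DualFunctor

variable {M : Type*} [AddCommGroup M] [Module ℂ M] [Module (GKRing G11) M] [IsScalarTower ℂ (GKRing G11) M]
  (hM : IsGKModule G11 (GKRing.actK G11 M) (GKRing.actLie G11 M))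
  {L : Type*} [AddCommGroup L] [Module ℂ L] [Module (GKRing G11) L] [IsScalarTower ℂ (GKRing G11) L]
  (hL : IsGKModule G11 (GKRing.actK G11 L) (GKRing.actLie G11 L))

/-! ## §3 (stated first) Counted forms -/

/-- `[M / rad M : L] ≥ 1 ⟺ L~ ↪ M~`, for `M` of finite length and `L` irreducible (`[M / rad M : L] = [soc(M~) : L~]`, g33-#5, and
occurrence in a socle is an embedding, g33-#12). [cite: BorelWallach2000, I §2] [cite: KnappVogan1995, §II.3 Prop. 2.53 (b)]
[cite: BerrickKeating2000, §4.1.13] -/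
theorem compMult_top_pos_iff_exists_injective_dual (hfl : IsFiniteLength (GKRing G11) M) [IsSimpleModule (GKRing G11) L] :
    0 < JordanHoelder.compMult (GKRing G11) (M ⧸ Module.jacobson (GKRing G11) M) L ↔
      ∃ f : GKDual.dualModule G11 hL →ₗ[GKRing G11] GKDual.dualModule G11 hM, Function.Injective f := by
  haveI : IsSimpleModule (GKRing G11) (GKDual.dualModule G11 hL) := (isSimpleModule_dualModule_iff hL).mpr inferInstance
  have hfl' : IsFiniteLength (GKRing G11) (GKDual.dualModule G11 hM) := (isFiniteLength_dualModule_iff hM).mpr hfl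
  rw [← compMult_socle_dualModule hM hL (U11HC.isAdmissibleGK_of_isFiniteLength hM hfl)]
  exact SocleRadical.compMult_socle_pos_iff_exists_injective _ hfl'

/-- `[soc M : L] ≥ 1 ⟺ M~ ↠ L~`, for `M` of finite length and `L` irreducible (`[soc M : L] = [M~ / rad(M~) : L~]`, g33-#5, and
occurrence in a top is a quotient, g33-#12). [cite: BorelWallach2000, I §2] [cite: KnappVogan1995, §II.3 Prop. 2.53 (b)]
[cite: Krause2021, Conventions «Radical»] -/
theorem compMult_socle_pos_iff_exists_surjective_dual (hfl : IsFiniteLength (GKRing G11) M) [IsSimpleModule (GKRing G11) L] :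
    0 < JordanHoelder.compMult (GKRing G11) (SocleRadical.socle (GKRing G11) M) L ↔
      ∃ g : GKDual.dualModule G11 hM →ₗ[GKRing G11] GKDual.dualModule G11 hL, Function.Surjective g := by
  haveI : IsSimpleModule (GKRing G11) (GKDual.dualModule G11 hL) := (isSimpleModule_dualModule_iff hL).mpr inferInstance
  have hfl' : IsFiniteLength (GKRing G11) (GKDual.dualModule G11 hM) := (isFiniteLength_dualModule_iff hM).mpr hfl
  rw [← compMult_top_dualModule hM hL (U11HC.isAdmissibleGK_of_isFiniteLength hM hfl)]
  exact SocleRadical.compMult_top_pos_iff_exists_surjective _ hfl'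

/-! ## §1 Quotients of `M` ⟷ submodules of `M~` -/

/-- **An irreducible `L` is a quotient of `M` iff `L~` is a submodule of `M~`** (`M` a `(𝔤, K)`-module of `U(1,1)` of finite length; maps
over the operator ring, `Hom_R = Hom_{(𝔤,K)}`). [cite: BorelWallach2000, 0 §2.5, I §2] [cite: KnappVogan1995, §II.3 Prop. 2.53 (b)] -/
theorem exists_surjective_iff_exists_injective_dual (hfl : IsFiniteLength (GKRing G11) M) [IsSimpleModule (GKRing G11) L] :
    (∃ g : M →ₗ[GKRing G11] L, Function.Surjective g) ↔
      ∃ f : GKDual.dualModule G11 hL →ₗ[GKRing G11] GKDual.dualModule G11 hM, Function.Injective f := by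
  rw [← SocleRadical.compMult_top_pos_iff_exists_surjective L hfl, compMult_top_pos_iff_exists_injective_dual hM hL hfl]

/-- **An irreducible `L` is a submodule of `M` iff `L~` is a quotient of `M~`.** [cite: BorelWallach2000, 0 §2.5, I §2]
[cite: KnappVogan1995, §II.3 Prop. 2.53 (b)] -/
theorem exists_injective_iff_exists_surjective_dual (hfl : IsFiniteLength (GKRing G11) M) [IsSimpleModule (GKRing G11) L] :
    (∃ f : L →ₗ[GKRing G11] M, Function.Injective f) ↔
      ∃ g : GKDual.dualModule G11 hM →ₗ[GKRing G11] GKDual.dualModule G11 hL, Function.Surjective g := by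
  rw [← SocleRadical.compMult_socle_pos_iff_exists_injective L hfl, compMult_socle_pos_iff_exists_surjective_dual hM hL hfl]

/-! ## §2 `Hom ≠ 0` forms (Schur) -/

/-- **`Hom_R(M, L) ≠ 0 ⟺ Hom_R(L~, M~) ≠ 0`** for `M` of finite length and `L` irreducible. [cite: BorelWallach2000, I §2]
[cite: KnappVogan1995, §II.3 Prop. 2.53 (b)] [cite: BerrickKeating2000, §4.1.13] -/
theorem exists_hom_ne_zero_iff_dual (hfl : IsFiniteLength (GKRing G11) M) [IsSimpleModule (GKRing G11) L] :
    (∃ g : M →ₗ[GKRing G11] L, g ≠ 0) ↔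
      ∃ f : GKDual.dualModule G11 hL →ₗ[GKRing G11] GKDual.dualModule G11 hM, f ≠ 0 := by
  haveI : IsSimpleModule (GKRing G11) (GKDual.dualModule G11 hL) := (isSimpleModule_dualModule_iff hL).mpr inferInstance
  have hfl' : IsFiniteLength (GKRing G11) (GKDual.dualModule G11 hM) := (isFiniteLength_dualModule_iff hM).mpr hfl
  rw [← SocleRadical.compMult_top_pos_iff_exists_ne_zero L hfl, ← SocleRadical.compMult_socle_pos_iff_exists_ne_zero _ hfl',
    compMult_socle_dualModule hM hL (U11HC.isAdmissibleGK_of_isFiniteLength hM hfl)]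

/-- **`Hom_R(L, M) ≠ 0 ⟺ Hom_R(M~, L~) ≠ 0`** for `M` of finite length and `L` irreducible. [cite: BorelWallach2000, I §2]
[cite: KnappVogan1995, §II.3 Prop. 2.53 (b)] [cite: BerrickKeating2000, §4.1.13] -/
theorem exists_hom_ne_zero_iff_dual' (hfl : IsFiniteLength (GKRing G11) M) [IsSimpleModule (GKRing G11) L] :
    (∃ f : L →ₗ[GKRing G11] M, f ≠ 0) ↔
      ∃ g : GKDual.dualModule G11 hM →ₗ[GKRing G11] GKDual.dualModule G11 hL, g ≠ 0 := by
  haveI : IsSimpleModule (GKRing G11) (GKDual.dualModule G11 hL) := (isSimpleModule_dualModule_iff hL).mpr inferInstance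
  have hfl' : IsFiniteLength (GKRing G11) (GKDual.dualModule G11 hM) := (isFiniteLength_dualModule_iff hM).mpr hfl
  rw [← SocleRadical.compMult_socle_pos_iff_exists_ne_zero L hfl, ← SocleRadical.compMult_top_pos_iff_exists_ne_zero _ hfl',
    compMult_top_dualModule hM hL (U11HC.isAdmissibleGK_of_isFiniteLength hM hfl)]

/-- The unique-irreducible-quotient form: `M / rad M` is irreducible and `≅ L` ⟹ `L~ ↪ M~` (the Langlands-quotient-to-subrepresentation
step). [cite: BorelWallach2000, I §2] [cite: KnappVogan1995, §II.3 Prop. 2.53 (b)] -/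
theorem exists_injective_dual_of_top_equiv (hfl : IsFiniteLength (GKRing G11) M) [IsSimpleModule (GKRing G11) L]
    (e : (M ⧸ Module.jacobson (GKRing G11) M) ≃ₗ[GKRing G11] L) :
    ∃ f : GKDual.dualModule G11 hL →ₗ[GKRing G11] GKDual.dualModule G11 hM, Function.Injective f :=
  (exists_surjective_iff_exists_injective_dual hM hL hfl).mp
    ⟨e.toLinearMap ∘ₗ (Module.jacobson (GKRing G11) M).mkQ, e.surjective.comp (Submodule.mkQ_surjective _)⟩

end U11DualFunctor

end Literature.RepresentationTheory.BorelWallach2000
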